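import Summits.BirchSwinnertonDyer.Rank1Residual.X11b.KolyvaginH44Concrete
import Summits.BirchSwinnertonDyer.Rank1Residual.X11b.KolyvaginPointClassFixed
import Summits.BirchSwinnertonDyer.Rank1Residual.X11b.KolyvaginPointInertia
import Summits.BirchSwinnertonDyer.Rank1Residual.X11b.RingClassFieldNoTorsion
import Summits.BirchSwinnertonDyer.Rank1Residual.X11b.RingClassFieldNoTorsionOfIrreducible
import Summits.BirchSwinnertonDyer.Rank1Residual.X11b.Three.HeegnerDiscriminantBound
import Literature.NumberTheory.GaloisRepresentations.DecomposedGenericInfinite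
import HarnessLib

/-!
# The concrete `h44`-at-divisors chain AT `p = 3` (`3 ∣ N`): `hD` discharged, `hPt` and `hI`
# supplied, dictionary concrete — the x11b3-side COMPOSITION (team N8/O2, seat x11b3-p8, R10-39/44/45)

Summit-side THEOREM-ONLY file (no definition, no named fact, no `sorry`); `K : Type` (the tree's
ring-class class field theory is universe `0`).  Cell `b2b-bsdres`, team x11b3, `h44` programme:
composition home of the concrete chain at `p = 3` (lead GEN 9, R10-39 (O1′)+, R10-44, R10-45).

HONEST FRAMING (cell `b2b-bsdres`, verbatim): this cell deletes COMBINATION-shaped residual classes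
from published theorems only; the CONSTRUCTION-shaped remainder is typed, not attempted; census output
is EVIDENCE, never a Literature fact; `X11 ∧ r = 1 ∧ p = 3` stays CONSTRUCTION-SHAPED; O2 OPEN / N8
CONSTRUCTION; this is not "finishing BSD".  HONEST FRAMING (H47, binding, this file): plumbing — the
three ENDs below compose already-landed tree theorems at `p := 3`; on ALL of X11b @ 3 (both image
cells) the CONCRETE `h44`-at-divisors chain is thereby a tree theorem CONDITIONAL ON (γ) = Gross 1991,
Prop. 3.7 (2) ALONE plus structural binders (lead R10-68, referee §27 ROUND 24); (γ) is cite-only, a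
LABELLED HYPOTHESIS `hγ`, NOT a Literature fact; `h37` is bypassed for concrete data only; `h37` /
`h44` on the residual map are NOT discharged (open up to (γ)); the finiteness theorem downstream
carries IN ADDITION the open leaf (R)_M = `hR` (R10-65) + `hexc` + `hK1` — no sentence here reads
"finiteness at 3 conditional on (γ) alone"; the node `Three.HsiehDescentAt₃` and the open content (t)
are unchanged; nothing is booked; no mark / label / count / tier moves.

READING OF RECORD (binding wording, R10-44; nothing moves): **the concrete `h44`-at-divisors chain at
`p = 3` is CONDITIONAL on (γ) = Gross 1991, Prop. 3.7 (2) — a LABELLED HYPOTHESIS `hγ`, cite-only,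
NOT a Literature fact — plus the admissibility input `hA` (Gross Lemma 4.3 / McCallum (5); supplied
from `Surj W 3` elsewhere, x11b3-p3 (P3-A), not consumed here) and structural data; `h37` is BYPASSED
for concrete data; `h37` / `h44` are NOT DISCHARGED on the residual map (open up to (γ)); the
labelled-set reading is the referee's; nothing booked; no mark / label / count / tier.**
x11b3-side composition: `hD` discharged (from `hND` + the orientation + `3 ∣ N`), `hPt` supplied
(x11b3-p4 (P4-A)), `hI` supplied (x11b3-p4 (P4-B)), dictionary concrete (x11b3-p2); remaining
labelled binders EXACTLY {`hA`} + {`hγ`}.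

## The composition (one theorem)

`Three.h44_concrete_at_three_of_congruence` is x11b3-p2's concrete END
`KolyvaginH44.h44_concrete_of_traceRelation_of_congruence` (`X11b/KolyvaginH44Concrete`; McCallum 1991,
Prop. 4.4 at `λ ∣ m` in order form for the CONCRETE classes `c_M(m) = (d m).kolyvaginClass`, at
every divisor `m` of one square-free top level `n`) SPECIALISED to `p := 3` with three of its five
labelled binders REMOVED:

* `hD : d_K < -4` (Gross §1: *"For simplicity, we assume that `D ≠ 3, 4`"*) := the term
  `Three.discr_lt_neg_four_of_isCoprime_of_dvd_sq_sub hK hND h3 (d n dvd_rfl).dvd_sq_sub`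
  (`X11b/Three/HeegnerDiscriminantBound`, x11b3-p8): at `3 ∣ N`, `(N, d_K) = 1` (`hND`) and the
  orientation `β² ≡ d_K (mod 4N)` carried by every level's datum force `d_K ≡ 1 (mod 3)`, hence
  `d_K ∉ {-3, -4}` — the ONLY new binder is `h3 : 3 ∣ N`;
* `hPt` (Gross Prop. 3.6 with (4.1): `[P(m)]` is `Γ_K`-invariant mod `3^M E(K_m)`) := x11b3-p4's
  `KolyvaginH44.kolyvaginPoint_mem_invPoints_of_dvd` (`X11b/KolyvaginPointClassFixed`), and
* `hI` (McCallum Lemma 4.3: inertia at `v ∤ m` fixes `P(m)`) := x11b3-p4's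
  `KolyvaginH44.smul_kolyvaginPoint_eq_of_mem_localInertia` (`X11b/KolyvaginPointInertia`),
  both stated over the ABSTRACT Euler data guarded by `m ∣ n`; the SEAM (x11b3-r2 NIT-2, lead R10-45)
  is closed here exactly as in x11b3-p2's own proof: at every level obtain the level data of
  `KolyvaginH44.exists_levelData` (`𝒢_m = ringClassGal ι m ↷ E(K[m])` through `pointGalHom`,
  `ρ_m` the inclusion, `iA_m` the identity, `L_m = m.primeFactors`), apply the two abstract ENDs at
  these data, and transport to the concrete texts — which mention only `d m` — by x11b3-p8's G1
  identification `KolyvaginH37Bridge.map_kolyvaginPoint_eq_derivedPoint` +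
  `bijOn_of_section_of_transversal` (the abstract Kolyvagin point IS `(d m).derivedPoint`) and the
  dictionary clause `j_m = (d m).toGeomPoints` (`(d m).pointsSubgroup = (d m).toGeomPoints.range` by
  definition).

Every other binder of the concrete END is carried VERBATIM in its order (`hK ι hHP hM hW Dt hND h3 hn
hKol d hcoh hγ hA`, with `p := 3`, `hp := Nat.prime_three`, `hp2 : 3 ≠ 2`), and the conclusion is
its conclusion verbatim at `p := 3`.

SECOND END (append-only v2, lead R10-41 / R10-43 / R10-48 / R10-52):
`Three.h44_concrete_at_three_of_congruence_of_surj_three` — the same with the last labelled binder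
`hA` REPLACED by the class-record binder `Surj W 3` (`ρ̄_{E,3}` onto `GL₂(𝔽₃)`), `hA` being
SUPPLIED by x11b3-p3's `RingClassNoTorsion.isAdmissible_pointsSubgroup_of_dvd`
(`X11b/RingClassFieldNoTorsion`: Gross Lemma 4.3 / McCallum (5) at the ring class field from
`Surj W p`); remaining labelled binders EXACTLY {`hγ`} + the class binder `Surj W 3`.  On an
irreducible-non-surjective sub-population `hA` stays a binder (first END).

THIRD END (append-only v3, lead R10-56 / R10-59 (2)):
`Three.h44_concrete_at_three_of_congruence_of_irreducible` — the same with `hA` REPLACED by the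
class-record binder `W.HasIrreducibleModPGaloisRep 3` (surjective or not), `hA` being SUPPLIED by
x11b3-p4's `NoTorsionIrr.isAdmissible_pointsSubgroup_of_hasIrreducibleModPGaloisRep_of_dvd`
(`X11b/RingClassFieldNoTorsionOfIrreducible`: irreducibility + Weil pairing + `3` unramified in `K` +
`3 ∤ n`), its two side conditions DISCHARGED inside from binders already present (`3 ∤ d_K` from
`hND` + `h3`, so `3` is unramified in `K` by Dedekind's discriminant theorem — Mathlib
`NumberField.not_dvd_discr_iff_isUnramifiedIn`, re-based to the places `v ∋ 3` of `ℚ` by the tree's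
`isUnramifiedIn_of_isUnramifiedIn_span` — the route found by x11b3-p2 GEN 9, preferred by the lead
R10-62 (2); Kolyvagin primes for `p = 3` are `≠ 3`); remaining labelled binders EXACTLY {`hγ`} + the
class binder `HasIrreducibleModPGaloisRep 3`.

## References
* [GrossLMS1991] B. H. Gross, *Kolyvagin's work on modular elliptic curves*, LMS LNS 153 (1991), §1
  (held `book:editornd-l-functions-arithmetic`, chunk 212 L16), §3 (3.1)–(3.5), Prop. 3.6,
  Prop. 3.7 (1)(2) (chunk 217 L19–22, proof chunk 218 L1), §4 (4.1), Lemma 4.3, (4.4), Prop. 6.2.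
* [McCallumLMS1991] W. G. McCallum, *Kolyvagin's work on Shafarevich–Tate groups*, ibid., §4
  (4)–(6), Lemma 4.3, Prop. 4.4.
-/

noncomputable section

open scoped Classical
open WeierstrassCurve Field NumberField IsDedekindDomain Finset
open Literature.NumberTheory.EllipticCurves Literature.NumberTheory.GaloisRepresentations
open Literature.NumberTheory.EllipticCurves.KolyvaginCocycle
open Literature.NumberTheory.EllipticCurves.KolyvaginEuler
open Literature.NumberTheory.EllipticCurves.RingClassField
open Literature.NumberTheory.EllipticCurves.ModularForms

namespace Summit.BirchSwinnertonDyer.Rank1Residual.X11b.Three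

-- `K : Type`: the tree's ring-class class field theory is universe `0`.
variable {K : Type} [Field K] [NumberField K] {N : ℕ} {W : WeierstrassCurve ℚ}

/-- **The concrete `h44`-at-divisors chain at `p = 3`, `3 ∣ N`: `hD` discharged, `hPt` / `hI`
supplied, dictionary concrete** (x11b3-side composition, lead GEN 9 R10-39 / R10-44 / R10-45).
For `K` imaginary quadratic with `ι : K → ℂ`, `E = W/ℚ` globally minimal with a modular
parametrisation `Dt` of level `N` prime to `d_K` (`hND`) and DIVISIBLE BY `3` (`h3`), a Heegner point
over `K`, `M ≥ 1`, the Weil pairing at `3` (`hW`), a square-free level `n` whose prime factors are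
Kolyvagin primes for `p = 3` with `Frob = Frob_∞` on `K(E[3^M])` (`hKol`), coherent Kolyvagin–Heegner
data `d m` at the divisors of `n` (`hcoh`), and the LABELLED inputs
* `hγ` = **Gross 1991, Prop. 3.7 (2)** (*"… we have the congruence `y_n ≡ Frob(λ_m)(y_m)
  (mod λ_n)"*) for the data at every `m ∣ n` — cite-only, NOT a Literature fact, NOT discharged;
* `hA` = Gross Lemma 4.3 / McCallum (5): `E(K_m) ⊆ E(K̄)` admissible for `3^M` (`m ∣ n`) — supplied
  from `Surj W 3` in x11b3-p3's file, NOT consumed here;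
the concrete classes `c_M(m) = (d m).kolyvaginClass Nat.prime_three M` satisfy McCallum's Prop. 4.4
at `λ ∣ m` in order form: for all `m ∣ n`, primes `ℓ ∣ m`, places `λ ∋ ℓ` and `a : ℕ`,
**`3^a c_M(m) ∈ Sel_λ ↔ 3^a c_M(m/ℓ) ∈ H¹(K_λ, E[3^M])_{tors-loc}`** — x11b3-p2's
`KolyvaginH44.h44_concrete_of_traceRelation_of_congruence` at `p := 3` with `hD :=
Three.discr_lt_neg_four_of_isCoprime_of_dvd_sq_sub hK hND h3 (d n dvd_rfl).dvd_sq_sub`, `hPt :=`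
x11b3-p4's `KolyvaginH44.kolyvaginPoint_mem_invPoints_of_dvd` and `hI :=` x11b3-p4's
`KolyvaginH44.smul_kolyvaginPoint_eq_of_mem_localInertia`, the latter two applied at the level data
of `KolyvaginH44.exists_levelData` and transported to the concrete texts by
`KolyvaginH37Bridge.map_kolyvaginPoint_eq_derivedPoint` / `bijOn_of_section_of_transversal` (the seam).
READING OF RECORD (R10-44): conditional on (γ) (labelled hypothesis, cite-only, NOT a fact) plus
`hA` and structural data; `h37` bypassed for concrete data; `h37` / `h44` NOT DISCHARGED on the
residual map (open up to (γ)); labelled-set reading = the referee's; remaining labelled binders EXACTLY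
{`hA`} + {`hγ`}; nothing booked. [cite: McCallumLMS1991, Prop. 4.4, Lemma 4.3, §4 (4)–(6)]
[cite: GrossLMS1991, Prop. 3.7 (2), Prop. 3.6, Lemma 4.3, §4 (4.1), §1 (chunk 212 L16)] -/
theorem h44_concrete_at_three_of_congruence [NeZero N] [W.IsElliptic] [W.IsGloballyMinimal]
    (hK : IsImaginaryQuadratic K) (ι : K →+* ℂ)
    {P : (W.baseChange K).toAffine.Point} (hHP : IsHeegnerPoint N W K P)
    {M : ℕ} (hM : 1 ≤ M) (hW : W.exists_weilPairing 3)
    (Dt : ModularParametrizationData W N) {β : ℤ}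
    (hND : IsCoprime (N : ℤ) (NumberField.discr K)) (h3 : 3 ∣ N)
    {n : ℕ} (hn : Squarefree n)
    (hKol : ∀ q ∈ n.primeFactors, IsKolyvaginPrime N W K 3 q ∧ FrobEqFrobInfty W K (3 ^ M) q)
    (d : (m : ℕ) → m ∣ n → KolyvaginHeegnerData Dt β ι m)
    (hcoh : ∀ (m : ℕ) (hm : m ∣ n) (ℓ : ℕ) (hℓ : ℓ ∈ m.primeFactors)
      (hle : ringClassField K ι (m / ℓ) ≤ ringClassField K ι m),
      letI : Algebra K ℂ := ι.toAlgebra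
      (d m hm).toGeomPoints
          (KolyvaginOperator.derivedPoint (pointGalHom W (ringClassField K ι m)) (d m hm).σ (m / ℓ)
            (d m hm).S
            (WeierstrassCurve.Affine.Point.map (W' := W)
              ((RingClassField.inclusion ι hle).restrictScalars ℚ)
              (d (m / ℓ) ((Nat.div_dvd_of_dvd (Nat.dvd_of_mem_primeFactors hℓ)).trans hm)).y)) =
        (d (m / ℓ) ((Nat.div_dvd_of_dvd (Nat.dvd_of_mem_primeFactors hℓ)).trans hm)).toGeomPoints
          (d (m / ℓ) ((Nat.div_dvd_of_dvd (Nat.dvd_of_mem_primeFactors hℓ)).trans hm)).derivedPoint)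
    (hγ : ∀ (m : ℕ) (hm : m ∣ n) (ℓ : ℕ) (hℓ : ℓ ∈ m.primeFactors) [Fact ℓ.Prime]
      (hΔ : ¬ (ℓ : ℤ) ∣ minimalDiscriminantInt W) (φ₀ : absoluteGaloisGroup (ZMod ℓ)),
      (∀ x : AlgebraicClosure (ZMod ℓ), φ₀ • x = x ^ ℓ) →
      ∀ (hle : ringClassField K ι (m / ℓ) ≤ ringClassField K ι m)
        (γ : ringClassField K ι m ≃ₐ[ℚ] ringClassField K ι m), γ ∈ ringClassGal ι m →
        geomReduction hΔ ((RatClosure.pointsEquiv (K := K) W).symm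
            ((d m hm).toGeomPoints (pointGalHom W (ringClassField K ι m) γ (d m hm).y))) =
          φ₀ • geomReduction hΔ ((RatClosure.pointsEquiv (K := K) W).symm
            ((d m hm).toGeomPoints (pointGalHom W (ringClassField K ι m) γ
              (WeierstrassCurve.Affine.Point.map (W' := W)
                ((RingClassField.inclusion ι hle).restrictScalars ℚ)
                (d (m / ℓ) ((Nat.div_dvd_of_dvd (Nat.dvd_of_mem_primeFactors hℓ)).trans hm)).y)))))
    (hA : ∀ (m : ℕ) (hm : m ∣ n),
      IsAdmissible (absoluteGaloisGroup K) (d m hm).pointsSubgroup ((3 ^ M : ℕ) : ℤ)) :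
    ∀ (m : ℕ) (hm : m ∣ n) (ℓ : ℕ), ℓ.Prime → ∀ (hℓm : ℓ ∣ m) (v : HeightOneSpectrum (𝓞 K)),
      (ℓ : 𝓞 K) ∈ v.asIdeal → ∀ a : ℕ,
        ((((3 : ℕ) : ℤ) ^ a) • (d m hm).kolyvaginClass Nat.prime_three M ∈
            selmerLocalKer (W.baseChange K) (v.adicCompletion K) ((3 ^ M : ℕ) : ℤ) ↔
          (((3 : ℕ) : ℤ) ^ a) •
              (d (m / ℓ) ((Nat.div_dvd_of_dvd hℓm).trans hm)).kolyvaginClass Nat.prime_three M ∈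
            (W.baseChange K).torsionLocalKer (v.adicCompletion K) ((3 ^ M : ℕ) : ℤ)) := by
  -- `hD` DISCHARGED at `3 ∣ N` (x11b3-p8, `HeegnerDiscriminantBound`): from `hND`, the orientation
  -- `β² ≡ d_K (mod 4N)` of the top datum, and `3 ∣ N`.
  have hD : NumberField.discr K < -4 :=
    discr_lt_neg_four_of_isCoprime_of_dvd_sq_sub hK hND h3 (d n dvd_rfl).dvd_sq_sub
  have hn0 : n ≠ 0 := Squarefree.ne_zero hn
  have hinert : ∀ q ∈ n.primeFactors, (Ideal.span {(q : 𝓞 K)}).IsPrime :=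
    fun q hq ↦ (hKol q hq).1.2.2.2.2.1
  -- THE SEAM (R10-45): level data at every level (x11b3-p2's `exists_levelData`)
  choose σ H f y π j e hord hj hπρ hfsec hHρ hdict hjunk using
    fun k ↦ KolyvaginH44.exists_levelData (W := W) (Dt := Dt) (β := β) hK ι hn hinert d k
  -- `𝒢_m = ringClassGal ι m`, a finite commutative group acting on `E(K[m])` through `pointGalHom`
  letI hcg : ∀ k, CommGroup (ringClassGal ι k) := fun k ↦
    { (inferInstance : Group (ringClassGal ι k)) with
      mul_comm := fun a b ↦ (KolyvaginH44.isMulCommutative_ringClassGal' hK ι k).is_comm.comm a b }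
  haveI hfin : ∀ k, Finite (ringClassGal ι k) := KolyvaginH44.finite_ringClassGal hK ι
  letI act : ∀ k, DistribMulAction (ringClassGal ι k)
      ((W.baseChange (ringClassField K ι k)).toAffine.Point) := fun k ↦
    DistribMulAction.compHom _ ((pointGalHom W (ringClassField K ι k)).comp (ringClassGal ι k).subtype)
  letI hft : ∀ k, Fintype (ringClassGal ι k ⧸ H k) := fun k ↦ Fintype.ofFinite _
  have hsmul : ∀ (k) (g : ringClassGal ι k) (Q : (W.baseChange (ringClassField K ι k)).toAffine.Point),
      g • Q = pointGalHom W (ringClassField K ι k)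
        (g : ringClassField K ι k ≃ₐ[ℚ] ringClassField K ι k) Q := fun _ _ _ ↦ rfl
  -- the inclusion `ρ_m : 𝒢_m ≤ Aut_ℚ(K[m])` (the identity `iA_m` is `AddEquiv.refl`)
  set ρ : ∀ k, ringClassGal ι k →* (ringClassField K ι k ≃ₐ[ℚ] ringClassField K ι k) :=
    fun k ↦ (ringClassGal ι k).subtype with hρdef
  have hρ : ∀ k, Function.Injective (ρ k) := fun k ↦ (ringClassGal ι k).subtype_injective
  have hj' : ∀ (k) (g : absoluteGaloisGroup K)
      (a : (W.baseChange (ringClassField K ι k)).toAffine.Point),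
      j k (π k g • a) = g • j k a := fun k g a ↦ by rw [hsmul]; exact hj k g a
  have hπρ' : ∀ (k) (τ : absoluteGaloisGroup K) (x : ringClassField K ι k),
      τ • e k x = e k (ρ k (π k τ) x) := fun k τ x ↦ hπρ k τ x
  -- the abstract Kolyvagin point IS `P(m)` at the divisors (x11b3-p8's G1)
  have hP : ∀ (k) (hk : k ∣ n),
      j k (kolyvaginPoint (σ k) k.primeFactors (f k) (y k)) =
        (d k hk).toGeomPoints (d k hk).derivedPoint := by
    intro k hk
    obtain ⟨hjk, hyk, hσk, hfS⟩ := hdict k hk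
    rw [hjk, hyk]
    congr 1
    have hbij := KolyvaginH37Bridge.bijOn_of_section_of_transversal (ρ k) (hρ k)
      (H := H k) (Γ := ringClassGal ι k) (G₁ := ringClassGalOver ι k 1) (hHρ k)
      (S := ((d k hk).S : Set _)) (fun s hs ↦ (d k hk).S_subset s hs)
      (fun s hs ↦ ⟨⟨s, (d k hk).S_subset s hs⟩, rfl⟩) (d k hk).S_transversal (f k) (hfsec k) hfS
    exact KolyvaginH37Bridge.map_kolyvaginPoint_eq_derivedPoint
      (pointGalHom W (ringClassField K ι k)) (ρ k) (AddMonoidHom.id _) (fun g a ↦ hsmul k g a)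
      (hn.squarefree_of_dvd hk) hσk (f k) hbij (d k hk).y
  -- the dictionary clauses the abstract ENDs read
  have hyA : ∀ (k : ℕ) (hk : k ∣ n), AddEquiv.refl _ (y k) = (d k hk).y :=
    fun k hk ↦ (hdict k hk).2.1
  have hσA : ∀ (k : ℕ) (hk : k ∣ n), ∀ q ∈ k.primeFactors, ρ k (σ k q) = (d k hk).σ q :=
    fun k hk ↦ (hdict k hk).2.2.1
  -- `hPt` SUPPLIED (x11b3-p4 (P4-A)) at the level data, transported along G1 + `j_m = toGeomPoints`
  have hPt : ∀ (m : ℕ) (hm : m ∣ n),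
      (d m hm).toGeomPoints (d m hm).derivedPoint ∈
        invPoints (absoluteGaloisGroup K) (d m hm).pointsSubgroup ((3 ^ M : ℕ) : ℤ) := by
    intro k hk
    have h := KolyvaginH44.kolyvaginPoint_mem_invPoints_of_dvd hK ι Dt Nat.prime_three hM hND hD hn
      hKol d σ (fun k ↦ k.primeFactors) H f y π j hj' ρ hρ (fun _ ↦ AddEquiv.refl _)
      (fun k _ g a ↦ hsmul k g a) hyA hσA (fun _ _ ↦ rfl) (fun k _ ↦ hfsec k) (fun k _ ↦ hHρ k)
      k hk
    rw [hP k hk, (hdict k hk).1] at h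
    exact h
  -- `hI` SUPPLIED (x11b3-p4 (P4-B)) at the level data, transported along G1
  have hI : ∀ (m : ℕ) (hm : m ∣ n), ∀ v : HeightOneSpectrum (𝓞 K), (m : 𝓞 K) ∉ v.asIdeal →
      ∀ 𝔐 ∈ v.localPrimesAbove, ∀ t ∈ 𝔐.inertia (absoluteGaloisGroup (v.adicCompletion K)),
        resGal (K := K) (v.adicCompletion K) t • (d m hm).toGeomPoints (d m hm).derivedPoint =
          (d m hm).toGeomPoints (d m hm).derivedPoint := by
    intro k hk w hkw 𝔐 h𝔐 t ht
    have h := KolyvaginH44.smul_kolyvaginPoint_eq_of_mem_localInertia (W := W) hK ι σ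
      (fun k ↦ k.primeFactors) H f y π j hj' e ρ hρ hπρ' k w hkw 𝔐 h𝔐 t ht
    rw [hP k hk] at h
    exact h
  -- x11b3-p2's concrete END at `p := 3`
  exact KolyvaginH44.h44_concrete_of_traceRelation_of_congruence hK ι hHP Nat.prime_three
    (by decide) hM hW Dt hND hD hn hKol d hcoh hγ hA hPt hI

/-- **The concrete `h44`-at-divisors chain at `p = 3` ON THE `Surj₃` CELL: `hD` discharged, `hPt` /
`hI` / `hA` supplied** (second END, lead GEN 9 R10-41 / R10-43 / R10-48).  The first END
`h44_concrete_at_three_of_congruence` with its admissibility binder `hA` (Gross 1991, Lemma 4.3 /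
McCallum 1991, §4 (5): *"`E` has no `K_n`-rational `p`-torsion"*) SUPPLIED from the class-record
binder `Surj W 3` (`ρ̄_{E,3} : Γ_ℚ → GL₂(𝔽₃)` onto) by x11b3-p3's
`RingClassNoTorsion.isAdmissible_pointsSubgroup_of_dvd` (Lemma 4.3
instantiated at the ring class fields `K[m]`, `m ∣ n`, `n ≠ 0`).  READING OF RECORD (R10-44 (3) with
R10-41's precision): on the `Surj₃` cell the concrete `h44`-at-divisors chain at `p = 3` is
CONDITIONAL on (γ) = Gross 1991, Prop. 3.7 (2) — labelled hypothesis `hγ`, cite-only, NOT a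
Literature fact — plus `Surj W 3` and structural data; on any irreducible-non-surjective
sub-population `hA` stays a binder (first END); `h37` bypassed for concrete data; `h37` / `h44` NOT
DISCHARGED on the residual map (open up to (γ)); labelled-set reading = the referee's; remaining
labelled binders EXACTLY {`hγ`} + the class binder `Surj W 3`; nothing booked.
[cite: McCallumLMS1991, Prop. 4.4, §4 (5)]
[cite: GrossLMS1991, Prop. 3.7 (2), Lemma 4.3, §4 (4.1)–(4.2)] -/
theorem h44_concrete_at_three_of_congruence_of_surj_three [NeZero N] [W.IsElliptic]
    [W.IsGloballyMinimal] (hK : IsImaginaryQuadratic K) (ι : K →+* ℂ)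
    {P : (W.baseChange K).toAffine.Point} (hHP : IsHeegnerPoint N W K P)
    {M : ℕ} (hM : 1 ≤ M) (hW : W.exists_weilPairing 3)
    (Dt : ModularParametrizationData W N) {β : ℤ}
    (hND : IsCoprime (N : ℤ) (NumberField.discr K)) (h3 : 3 ∣ N)
    {n : ℕ} (hn : Squarefree n)
    (hKol : ∀ q ∈ n.primeFactors, IsKolyvaginPrime N W K 3 q ∧ FrobEqFrobInfty W K (3 ^ M) q)
    (d : (m : ℕ) → m ∣ n → KolyvaginHeegnerData Dt β ι m)
    (hcoh : ∀ (m : ℕ) (hm : m ∣ n) (ℓ : ℕ) (hℓ : ℓ ∈ m.primeFactors)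
      (hle : ringClassField K ι (m / ℓ) ≤ ringClassField K ι m),
      letI : Algebra K ℂ := ι.toAlgebra
      (d m hm).toGeomPoints
          (KolyvaginOperator.derivedPoint (pointGalHom W (ringClassField K ι m)) (d m hm).σ (m / ℓ)
            (d m hm).S
            (WeierstrassCurve.Affine.Point.map (W' := W)
              ((RingClassField.inclusion ι hle).restrictScalars ℚ)
              (d (m / ℓ) ((Nat.div_dvd_of_dvd (Nat.dvd_of_mem_primeFactors hℓ)).trans hm)).y)) =
        (d (m / ℓ) ((Nat.div_dvd_of_dvd (Nat.dvd_of_mem_primeFactors hℓ)).trans hm)).toGeomPoints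
          (d (m / ℓ) ((Nat.div_dvd_of_dvd (Nat.dvd_of_mem_primeFactors hℓ)).trans hm)).derivedPoint)
    (hγ : ∀ (m : ℕ) (hm : m ∣ n) (ℓ : ℕ) (hℓ : ℓ ∈ m.primeFactors) [Fact ℓ.Prime]
      (hΔ : ¬ (ℓ : ℤ) ∣ minimalDiscriminantInt W) (φ₀ : absoluteGaloisGroup (ZMod ℓ)),
      (∀ x : AlgebraicClosure (ZMod ℓ), φ₀ • x = x ^ ℓ) →
      ∀ (hle : ringClassField K ι (m / ℓ) ≤ ringClassField K ι m)
        (γ : ringClassField K ι m ≃ₐ[ℚ] ringClassField K ι m), γ ∈ ringClassGal ι m →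
        geomReduction hΔ ((RatClosure.pointsEquiv (K := K) W).symm
            ((d m hm).toGeomPoints (pointGalHom W (ringClassField K ι m) γ (d m hm).y))) =
          φ₀ • geomReduction hΔ ((RatClosure.pointsEquiv (K := K) W).symm
            ((d m hm).toGeomPoints (pointGalHom W (ringClassField K ι m) γ
              (WeierstrassCurve.Affine.Point.map (W' := W)
                ((RingClassField.inclusion ι hle).restrictScalars ℚ)
                (d (m / ℓ) ((Nat.div_dvd_of_dvd (Nat.dvd_of_mem_primeFactors hℓ)).trans hm)).y)))))
    (hsurj : Rank1Residual.Surj W 3) :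
    ∀ (m : ℕ) (hm : m ∣ n) (ℓ : ℕ), ℓ.Prime → ∀ (hℓm : ℓ ∣ m) (v : HeightOneSpectrum (𝓞 K)),
      (ℓ : 𝓞 K) ∈ v.asIdeal → ∀ a : ℕ,
        ((((3 : ℕ) : ℤ) ^ a) • (d m hm).kolyvaginClass Nat.prime_three M ∈
            selmerLocalKer (W.baseChange K) (v.adicCompletion K) ((3 ^ M : ℕ) : ℤ) ↔
          (((3 : ℕ) : ℤ) ^ a) •
              (d (m / ℓ) ((Nat.div_dvd_of_dvd hℓm).trans hm)).kolyvaginClass Nat.prime_three M ∈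
            (W.baseChange K).torsionLocalKer (v.adicCompletion K) ((3 ^ M : ℕ) : ℤ)) :=
  h44_concrete_at_three_of_congruence hK ι hHP hM hW Dt hND h3 hn hKol d hcoh hγ
    (fun m hm ↦ RingClassNoTorsion.isAdmissible_pointsSubgroup_of_dvd hK
      (Squarefree.ne_zero hn) d Nat.prime_three (by decide) hsurj M m hm)

/-- **The concrete `h44`-at-divisors chain at `p = 3` ON THE IRREDUCIBLE CELL: `hD` discharged,
`hPt` / `hI` / `hA` supplied** (third END, lead GEN 9 R10-56 / R10-59 (2)).  The first END
`h44_concrete_at_three_of_congruence` with its admissibility binder `hA` (Gross 1991, Lemma 4.3 /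
McCallum 1991, §4 (5): *"`E` has no `K_n`-rational `p`-torsion"*) SUPPLIED from the class-record
binder `W.HasIrreducibleModPGaloisRep 3` (`E[3]` an IRREDUCIBLE `Γ_ℚ`-module — surjective or not) by
x11b3-p4's `NoTorsionIrr.isAdmissible_pointsSubgroup_of_hasIrreducibleModPGaloisRep_of_dvd`
(`X11b/RingClassFieldNoTorsionOfIrreducible`: Lemma 4.3 without surjectivity at the ring class fields
`K[m]`, `m ∣ n`, from irreducibility + the Weil pairing `hW` + `3` unramified in `K` + `3 ∤ n`), whose
two side conditions are DISCHARGED here from binders already present: `3` is unramified in `K`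
because `3 ∤ d_K` (`hND : (N, d_K) = 1` and `h3 : 3 ∣ N`) — Dedekind's discriminant theorem, Mathlib
`NumberField.not_dvd_discr_iff_isUnramifiedIn`, re-based to the places `v ∋ 3` of `ℚ` by the tree's
`isUnramifiedIn_of_isUnramifiedIn_span` (route of x11b3-p2 GEN 9, preferred R10-62 (2)) —, and
`3 ∤ n` because every prime factor of `n` is a Kolyvagin prime for `p = 3`, hence `≠ 3` (Gross
(3.1) `ℓ ∤ N·D·p`, the clause `ℓ ≠ p` of `IsKolyvaginPrime`).  READING (R10-44 (3) with R10-41 /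
R10-59 precision; the lead states the reading of record after landing): on the irreducible cell of X11b@3
the concrete `h44`-at-divisors chain at `p = 3` is CONDITIONAL on (γ) = Gross 1991, Prop. 3.7 (2) —
labelled hypothesis `hγ`, cite-only, NOT a Literature fact — plus `HasIrreducibleModPGaloisRep 3` and
structural data; `h37` bypassed for concrete data; `h37` / `h44` NOT DISCHARGED on the residual map
(open up to (γ)); labelled-set reading = the referee's; remaining labelled binders EXACTLY {`hγ`} +
the class binder `hirr`; nothing booked. [cite: McCallumLMS1991, Prop. 4.4, §4 (5)]
[cite: GrossLMS1991, Prop. 3.7 (2), Lemma 4.3, §3 (3.1), §4 (4.1)–(4.2)] -/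
theorem h44_concrete_at_three_of_congruence_of_irreducible [NeZero N] [W.IsElliptic]
    [W.IsGloballyMinimal] (hK : IsImaginaryQuadratic K) (ι : K →+* ℂ)
    {P : (W.baseChange K).toAffine.Point} (hHP : IsHeegnerPoint N W K P)
    {M : ℕ} (hM : 1 ≤ M) (hW : W.exists_weilPairing 3)
    (Dt : ModularParametrizationData W N) {β : ℤ}
    (hND : IsCoprime (N : ℤ) (NumberField.discr K)) (h3 : 3 ∣ N)
    {n : ℕ} (hn : Squarefree n)
    (hKol : ∀ q ∈ n.primeFactors, IsKolyvaginPrime N W K 3 q ∧ FrobEqFrobInfty W K (3 ^ M) q)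
    (d : (m : ℕ) → m ∣ n → KolyvaginHeegnerData Dt β ι m)
    (hcoh : ∀ (m : ℕ) (hm : m ∣ n) (ℓ : ℕ) (hℓ : ℓ ∈ m.primeFactors)
      (hle : ringClassField K ι (m / ℓ) ≤ ringClassField K ι m),
      letI : Algebra K ℂ := ι.toAlgebra
      (d m hm).toGeomPoints
          (KolyvaginOperator.derivedPoint (pointGalHom W (ringClassField K ι m)) (d m hm).σ (m / ℓ)
            (d m hm).S
            (WeierstrassCurve.Affine.Point.map (W' := W)
              ((RingClassField.inclusion ι hle).restrictScalars ℚ)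
              (d (m / ℓ) ((Nat.div_dvd_of_dvd (Nat.dvd_of_mem_primeFactors hℓ)).trans hm)).y)) =
        (d (m / ℓ) ((Nat.div_dvd_of_dvd (Nat.dvd_of_mem_primeFactors hℓ)).trans hm)).toGeomPoints
          (d (m / ℓ) ((Nat.div_dvd_of_dvd (Nat.dvd_of_mem_primeFactors hℓ)).trans hm)).derivedPoint)
    (hγ : ∀ (m : ℕ) (hm : m ∣ n) (ℓ : ℕ) (hℓ : ℓ ∈ m.primeFactors) [Fact ℓ.Prime]
      (hΔ : ¬ (ℓ : ℤ) ∣ minimalDiscriminantInt W) (φ₀ : absoluteGaloisGroup (ZMod ℓ)),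
      (∀ x : AlgebraicClosure (ZMod ℓ), φ₀ • x = x ^ ℓ) →
      ∀ (hle : ringClassField K ι (m / ℓ) ≤ ringClassField K ι m)
        (γ : ringClassField K ι m ≃ₐ[ℚ] ringClassField K ι m), γ ∈ ringClassGal ι m →
        geomReduction hΔ ((RatClosure.pointsEquiv (K := K) W).symm
            ((d m hm).toGeomPoints (pointGalHom W (ringClassField K ι m) γ (d m hm).y))) =
          φ₀ • geomReduction hΔ ((RatClosure.pointsEquiv (K := K) W).symm
            ((d m hm).toGeomPoints (pointGalHom W (ringClassField K ι m) γ
              (WeierstrassCurve.Affine.Point.map (W' := W)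
                ((RingClassField.inclusion ι hle).restrictScalars ℚ)
                (d (m / ℓ) ((Nat.div_dvd_of_dvd (Nat.dvd_of_mem_primeFactors hℓ)).trans hm)).y)))))
    (hirr : W.HasIrreducibleModPGaloisRep 3) :
    ∀ (m : ℕ) (hm : m ∣ n) (ℓ : ℕ), ℓ.Prime → ∀ (hℓm : ℓ ∣ m) (v : HeightOneSpectrum (𝓞 K)),
      (ℓ : 𝓞 K) ∈ v.asIdeal → ∀ a : ℕ,
        ((((3 : ℕ) : ℤ) ^ a) • (d m hm).kolyvaginClass Nat.prime_three M ∈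
            selmerLocalKer (W.baseChange K) (v.adicCompletion K) ((3 ^ M : ℕ) : ℤ) ↔
          (((3 : ℕ) : ℤ) ^ a) •
              (d (m / ℓ) ((Nat.div_dvd_of_dvd hℓm).trans hm)).kolyvaginClass Nat.prime_three M ∈
            (W.baseChange K).torsionLocalKer (v.adicCompletion K) ((3 ^ M : ℕ) : ℤ)) := by
  have hn0 : n ≠ 0 := Squarefree.ne_zero hn
  -- `3 ∤ n`: every prime factor of `n` is a Kolyvagin prime for `p = 3`, hence `≠ 3` (Gross (3.1))
  have hpn : ¬ 3 ∣ n := fun h3n ↦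
    (hKol 3 (Nat.mem_primeFactors.mpr ⟨Nat.prime_three, h3n, hn0⟩)).1.2.2.2.1 rfl
  -- `3 ∤ d_K` (`hND` + `h3`), so `3` is unramified in `K` (Dedekind's discriminant theorem), at
  -- every place `v ∋ 3` of `ℚ` (x11b3-p2 GEN 9's route, R10-62 (2))
  have h3N : (3 : ℤ) ∣ (N : ℤ) := by exact_mod_cast h3
  have h3d : ¬ (3 : ℤ) ∣ NumberField.discr K := fun hd ↦ by
    have hu := hND.isUnit_of_dvd' h3N hd
    rw [Int.isUnit_iff] at hu
    omega
  have hKunr : ∀ v : HeightOneSpectrum (𝓞 ℚ), ((3 : ℕ) : 𝓞 ℚ) ∈ v.asIdeal →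
      Algebra.IsUnramifiedIn (𝓞 K) v.asIdeal :=
    isUnramifiedIn_of_isUnramifiedIn_span Nat.prime_three
      ((NumberField.not_dvd_discr_iff_isUnramifiedIn K (𝓞 K)
        (Nat.prime_iff_prime_int.mp Nat.prime_three)).mp (by exact_mod_cast h3d))
  exact h44_concrete_at_three_of_congruence hK ι hHP hM hW Dt hND h3 hn hKol d hcoh hγ
    (fun m hm ↦ NoTorsionIrr.isAdmissible_pointsSubgroup_of_hasIrreducibleModPGaloisRep_of_dvd hK
      hn0 d Nat.prime_three (by decide) hirr hW hKunr hpn M m hm)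

end Summit.BirchSwinnertonDyer.Rank1Residual.X11b.Three

end
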